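import Summits.ABC.IUTFork.Conditional.InhUniformBandCellsReyssat151
import Summits.ABC.IUTFork.Conditional.InhUniformBandCellsFrey343
import Summits.ABC.IUTFork.Conditional.InhUniformBandShapesReyssat
import HarnessLib

/-!
# R-W WINDOW-TABLE, W3 «UNIFORM LEMMA» lane, INHABITED side — `2 + 3¹⁰·109 = 23⁵` AT EVERY LEVEL `l ≥ 151`: the hull licence S_H HOLDS at EVERY genuine
# Θ-volume datum over `(ratPoint (2/23⁵), l)` for EVERY prime `l ≥ 151`, with NO local-type hypothesis (row «W:INHABITED-BANDS», abc-iut-plan g10 C-R72)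

PROOF-ONLY file (D-0012; 0 definitions, 0 `Prop` facts) of the abc-iut cell — D-0079 RESCUE sub-cell R-W «WINDOW Θ-SIDE INEQUALITY», seat
abc-iut-W-num-6 (gen 3; numerics crew 6/6, band/wrapper specialist); consumer of abc-iut-rw-num-lead's INHABITED-UNIFORM-CERTS.tsv
(sha16 572449ea63f1d45c), re-derived by this seat's second engine (HOME/abc-iut-W-num-6/inhband/) with the kernel's one-sided inputs. Pattern of
abc-iut-w4-d094's row 5 (`WRowFrey343Inhabited`) / abc-iut-W-row-1's rows 1–4 (`WRowFrey283Unconditional*`) / abc-iut-W-row-2's rows 6–8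
(`AbcOfSGenuineKWildInhabitedRow73Unconditional`) with the level `l` made a VARIABLE: the same socket (abc-iut-W-row-1's
`Cor312Prov.licence_settingPrVolSharp_pilotDataOfK_of_orders_rat` over abc-iut-w4-d036's exact cell p460046/p460573 and abc-iut-c312-5's T2 content
theorem), the same conjugacy of the bad fibre at `d_mod = 1` (`WRow.absRamificationIdx_kOf_eq_of_finrank_eq_one`,
`Cor312Prov.nonempty_algEquiv_kOf_of_finrank_eq_one`), the same one-sided local inputs — and, in place of the labels of ONE level decided one by one,
this seat's UNIFORM cells `InhBand.cell_frey343_p3` (`InhUniformBandCellsFrey343`), `InhBand.cell_reyssat_p23_from151` (`InhUniformBandCellsReyssat151`: at `l = 151` the `m = 1` cells EXACTLY — floor included — and `m ≥ 2` floor-free; at `l ≥ 153` the uniform `InhBand.cell_reyssat_p23`) and `InhBand.cell_reyssat_p109` (`InhUniformBandCellsReyssat`) (floor dropped, convex in the label, both ends polynomial in `l`: `InhBand.quad_nonpos_of_ends`), valid at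
EVERY level `l ≥ 151`, EVERY admissible index and EVERY label. TAKES NO SIDE on [IUTchIII] Cor. 3.12 (S. Mochizuki, *Inter-universal Teichmüller
theory III*, Cor. 3.12 p. 173–174; Step (xi-f) p. 184) or on any author; «inhabited as typed» ≠ «asserted in print».

INPUTS AT A BAD FIBRE POINT `x | p` OF A DATUM OVER `(ratPoint (2/23⁵), l)` (`InhBand.bad_prime_reyssat` (`InhUniformBandShapesReyssat`): `p ∈ {3, 23, 109} ∖ {l}`, `ord_p j = −20, −10, −2`): `D = 2e − 1` over the WILD `3` (`3 ∤ 10`: abc-iut-W-neg-1's `GenuineK.sub_one_div_le_differentOrd_kOf_wild_ratPoint`), `D = e − 1` over `23, 109`; `ρin = ⌊e/22⌋` over `23` (abc-iut-c312-5's integer slot, `WRow.inner_witness_slot`), `1` elsewhere; `(a,b) = (3,4), (2,1), (0,1)`; threshold `L₀ = 151` (`l` prime, so `l ≠ 152`): this file SUPERSEDES `InhUniformBandReyssat` (`l ≥ 153`) by the one residual prime `l = 151`, where the floor of the exact cell is needed at `(m, j) = (1, 75)` (`InhUniformBandCellsReyssat151`, `decide` on the `75` exact cells) — with the K- and M-line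 REFUTATIONS at every `l ≤ 149` in tree, the Reyssat datum is thereby DECIDED AT EVERY PRIME `l` as typed (refuted `l ≤ 149` mod their inputs; inhabited `l ≥ 151` unconditionally). The index is ONE unknown `e_p = E₀(p)·l·m` per
prime (isometric conjugate fibre; `InhBand.shape_reyssat`: `E₀ = 6, 6, 15` — over `23` the factor `2` is abc-iut-w4-d107's UNCONDITIONAL twist at the odd pole `ord_23 λ = −5`); `ρout = min(p^a − a·e, p^b − b·e)` by abc-iut-c312-3's envelope (`WRow.outer_member_min`), `e` being off
the cyclotomic indices `p^c(p−1)` by `WRow.natCast_ne_pow_mul_sub_one` (with the prime `l ∤ p − 1` at `p ∈ {3,5}`, else a prime `3` or `5` dividing `E₀(p)`).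

WHAT IS PROVED (namespace `Summit.ABC.IUTFork.Conditional`): **`WRow.licence_reyssat_from151_uniform`** — for EVERY prime `l ≥ 151`, EVERY genuine Θ-volume datum `T` at
`(ratPoint (2/23⁵), l)` and EVERY pair of realising Θ- and q-ideles, abc-iut-c312-1's `Thm311ToCor312.Licence` HOLDS at
`settingPrVolSharp (pilotDataOfK T.D T.K) …`; **`WRow.exists_qPinned_and_hull_reyssat_from151_uniform`** — hence branch C's «∃ ρ qK, QPinned ∧ PilotKummerCompatHull»
(the per-datum S_H object of the window certificates' binder `hSHwBad`, p453137 / p450130) is INHABITED at every such datum.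
READING (neutral; numbers, not adjectives): for this known abc triple OUR typed hull clause holds at OUR sharp genuine `K`-setting for the whole datum
class at every prime level `l ≥ 151` — the R-W table's datum `frey-2-6436341-6436343 (Reyssat)` is DECIDED (inhabited side) at every such `l` by ONE
theorem; no number-level and no local-type hypothesis is consumed. Admissibility / (P6) of `(ratPoint λ, l)` and NON-EMPTINESS of the datum type are
NOT claimed. HONEST SCOPE: OUR sharp containers; STRONGER-THAN-PRINT hull reading; nothing about the printed inequality or any author's intended hull;
typed ≠ proved; instantiated ≠ endorsed; inhabited-as-typed ≠ true-in-print; no abc claim.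
[cite: Mochizuki2012, IUTchI Def. 3.1 (b),(c) pp. 61–62, Rmk. 3.1.5 p. 65, Ex. 3.2 (iv) p. 71; IUTchIII Cor. 3.12 Step (xi-f) p. 184; IUTchIV
Prop. 1.1 p. 9, Prop. 1.2 (i)(ii) p. 10, Prop. 1.3 (i) p. 11, Prop. 1.4 (ii) p. 13, Thm. 1.10 p. 22, Cor. 2.2 (ii) proof (P5) p. 46]
[cite: DupuyHilado2025, §3.3, §3.4, §4.9, §4.12] [cite: NeukirchANT1999, Ch. II (5.5)–(5.7)] [cite: CasselsFrohlichANT1967, Ch. VII Prop. 1.2 (ii)]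
[cite: SilvermanATAEC1994, V.5 Thm. 5.3 and Cor. 5.4] [cite: SerreLocalFields1979, Ch. III §6 Prop. 13] [claim: Mochizuki2012, status: disputed] for every IUT sentence.
-/

noncomputable section

open Set Function Metric NumberField IsDedekindDomain

namespace Summit.ABC.IUTFork.Conditional

open Thm311 Thm311.Real Cor312 Cor312Vol Cor312Prov Literature.IUT.LogThetaLattice Literature.IUT.LogVolume
  Literature.IUT.HodgeTheaters Literature.IUT.LogVolume.Cor22
open Literature.NumberTheory.NumberFields Literature.NumberTheory.GaloisRepresentations.Ultrametric
open Literature.NumberTheory.DiophantineGeometry Literature.NumberTheory.DiophantineGeometry.GenEll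


/-! ## THE THEOREM: S_H INHABITED at every genuine datum over `(ratPoint λ, l)`, every prime `l ≥ 151` — no local-type hypothesis -/

/-- **W3 «UNIFORM LEMMA», INHABITED SIDE, UNCONDITIONAL — `2 + 3¹⁰·109 = 23⁵` at EVERY level `l ≥ 151`.** For EVERY prime `l ≥ 151`, EVERY genuine
Θ-volume datum `T` at `(ratPoint (2/23⁵), l)` ([IUTchIV] Cor. 2.2 (ii) proof (P7)) and EVERY pair of Θ- and q-ideles realising the pilot divisors of
`X := pilotDataOfK T.D T.K`, abc-iut-c312-1's `Thm311ToCor312.Licence` HOLDS at abc-iut-c312-7's `settingPrVolSharp X …`. NO local-type and NO conjugacy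
hypothesis: the bad primes are `{3, 23, 109} ∖ {l}`; the bad completions over each are isometrically `ℚ_p`-isomorphic (`d_mod = 1`), so the
ramification index is a single unknown `e_p = E₀(p)·l·m` per prime (`InhBand.shape_reyssat`); the socket's one-sided inputs are `D = 2e − 1` (wild) / `e − 1`,
`ρin = ⌊e/(p−1)⌋` / `1`, `ρout = min(p^a − a·e, p^b − b·e)`, `h = 2·v_p(abc)`; the integer cells hold at every label for every such `e` and every such `l`
(`InhBand.cell_frey343_p3` (`InhUniformBandCellsFrey343`), `InhBand.cell_reyssat_p23_from151` (`InhUniformBandCellsReyssat151`: at `l = 151` the `m = 1` cells EXACTLY — floor included — and `m ≥ 2` floor-free; at `l ≥ 153` the uniform `InhBand.cell_reyssat_p23`) and `InhBand.cell_reyssat_p109` (`InhUniformBandCellsReyssat`)). [cite: Mochizuki2012, IUTchIII Cor. 3.12 Step (xi-f) p. 184; IUTchIV Prop. 1.1 p. 9, Prop. 1.2 (i)(ii) p. 10, Cor. 2.2 (ii) p. 46]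
[cite: DupuyHilado2025, §3.3, §3.4, §4.9, §4.12] [claim: Mochizuki2012, status: disputed] -/
theorem WRow.licence_reyssat_from151_uniform {l : ℕ} (hl : 151 ≤ l) (T : Cor22.ThetaVolumeDatumAt (ratPoint (((2 : ℕ) : ℚ) / (23 ^ 5 : ℕ))) l) :
    letI := T.instFieldF; letI := T.instNumberFieldF; letI := T.instAlgebraF; letI := T.instFieldK
    letI := T.instNumberFieldK; letI := T.instAlgebraK; letI := T.instFieldFbar; letI := T.instAlgebraFbar
    letI := T.instAlgebraKFbar; letI := T.instIsElliptic
    ∀ {logv : PadicLogs T.K} (hlog : LogvAnalytic logv) (M : Type) [Field M] [NumberField M]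
      (archPk : ∀ (j : (thetaIndex (pilotDataOfK T.D T.K)).Label) (vQ : (thetaIndex (pilotDataOfK T.D T.K)).VQ),
        Set ((logShellsDH (pilotDataOfK T.D T.K) logv).Packet j vQ))
      (archSub : ∀ (j : (thetaIndex (pilotDataOfK T.D T.K)).Label) (v : (thetaIndex (pilotDataOfK T.D T.K)).V),
        Set ((logShellsDH (pilotDataOfK T.D T.K) logv).Packet j ((thetaIndex (pilotDataOfK T.D T.K)).over v)))
      (Ψ : ℤ → ∀ v : (thetaIndex (pilotDataOfK T.D T.K)).V, v ∈ (thetaIndex (pilotDataOfK T.D T.K)).Vbad →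
        Set ((logShellsDH (pilotDataOfK T.D T.K) logv).StarPacket v))
      (act : ℤ → ∀ v : (thetaIndex (pilotDataOfK T.D T.K)).V, v ∈ (thetaIndex (pilotDataOfK T.D T.K)).Vbad →
        (logShellsDH (pilotDataOfK T.D T.K) logv).StarPacket v → Module.End ℚ ((logShellsDH (pilotDataOfK T.D T.K) logv).StarPacket v))
      (Mmod : ℤ → ∀ j : (thetaIndex (pilotDataOfK T.D T.K)).LabelStar, Set ((logShellsDH (pilotDataOfK T.D T.K) logv).GlobalPacket j.1))
      (region : ℤ → ∀ j : (thetaIndex (pilotDataOfK T.D T.K)).LabelStar, FinDivisor M → ∀ vQ : (thetaIndex (pilotDataOfK T.D T.K)).VQ,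
        Set ((logShellsDH (pilotDataOfK T.D T.K) logv).Packet j.1 vQ))
      (n : ℤ) {HT : Type} {LogLink : HT → HT → Type} {IsFull : ∀ {s t : HT}, LogLink s t → Prop}
      (lat : LGPGaussianLogThetaLattice LogLink IsFull)
      {Frd : Type} {IsoF : Frd → Frd → Type} {Ob : Frd → Type} {realify : Frd → Frd} {Strip : Type}
      {IsoS : Strip → Strip → Type} {Mv : ∀ v : (thetaIndex (pilotDataOfK T.D T.K)).V, v ∈ (thetaIndex (pilotDataOfK T.D T.K)).Vbad → Type}
      [∀ v h, Monoid (Mv v h)]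
      (sig : GlobalLGPFrobenioidSignature (thetaIndex (pilotDataOfK T.D T.K)).lstar (thetaIndex (pilotDataOfK T.D T.K)).V
        (· ∈ (thetaIndex (pilotDataOfK T.D T.K)).Vbad) Frd IsoF Ob realify Strip IsoS Mv)
      (split : SplittingMonoids Mv) {ObΔ : Type} {N : ∀ v : (thetaIndex (pilotDataOfK T.D T.K)).V, v ∈ (thetaIndex (pilotDataOfK T.D T.K)).Vbad → Type}
      [∀ v h, Monoid (N v h)] (qData : QPilotData ObΔ N)
      (tq : ∀ (pp : Nat.Primes) (x : (thetaIndex (pilotDataOfK T.D T.K)).Fibre (.inr pp)),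
        haveI : Fact (pp : ℕ).Prime := ⟨pp.2⟩; kOf (pilotDataOfK T.D T.K) pp.1 x)
      (t : ∀ (pp : Nat.Primes) (_ : Fin (pilotDataOfK T.D T.K).lstar) (x : (thetaIndex (pilotDataOfK T.D T.K)).Fibre (.inr pp)),
        haveI : Fact (pp : ℕ).Prime := ⟨pp.2⟩; kOf (pilotDataOfK T.D T.K) pp.1 x)
      (htq0 : ∀ pp x, tq pp x ≠ 0)
      (htq1 : ∀ (pp : Nat.Primes) (x : (thetaIndex (pilotDataOfK T.D T.K)).Fibre (.inr pp)),
        haveI : Fact (pp : ℕ).Prime := ⟨pp.2⟩; placeOf (pilotDataOfK T.D T.K) pp.1 x ∉ (pilotDataOfK T.D T.K).S → ‖tq pp x‖ = 1)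
      (_ht0 : ∀ pp i x, t pp i x ≠ 0)
      (_ht : ∀ (pp : Nat.Primes) (i : Fin (pilotDataOfK T.D T.K).lstar) (x : (thetaIndex (pilotDataOfK T.D T.K)).Fibre (.inr pp)),
        haveI : Fact (pp : ℕ).Prime := ⟨pp.2⟩
        Real.log ‖t pp i x‖ = -((pilotDataOfK T.D T.K).thetaPilot i (placeOf (pilotDataOfK T.D T.K) pp.1 x)) *
          logNorm T.K (placeOf (pilotDataOfK T.D T.K) pp.1 x) / localDegree T.K (placeOf (pilotDataOfK T.D T.K) pp.1 x))
      (_htq : ∀ (pp : Nat.Primes) (x : (thetaIndex (pilotDataOfK T.D T.K)).Fibre (.inr pp)),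
        haveI : Fact (pp : ℕ).Prime := ⟨pp.2⟩
        Real.log ‖tq pp x‖ = -((pilotDataOfK T.D T.K).qPilot (placeOf (pilotDataOfK T.D T.K) pp.1 x)) *
          logNorm T.K (placeOf (pilotDataOfK T.D T.K) pp.1 x) / localDegree T.K (placeOf (pilotDataOfK T.D T.K) pp.1 x)),
      Thm311ToCor312.Licence
        (settingPrVolSharp (pilotDataOfK T.D T.K) hlog M archPk archSub Ψ act Mmod region n lat sig split qData tq t htq0 htq1) := by
  classical
  letI := T.instFieldF; letI := T.instNumberFieldF; letI := T.instAlgebraF; letI := T.instFieldK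
  letI := T.instNumberFieldK; letI := T.instAlgebraK; letI := T.instFieldFbar; letI := T.instAlgebraFbar
  letI := T.instAlgebraKFbar; letI := T.instIsElliptic
  intro logv hlog M _ _ archPk archSub Ψ act Mmod region n HT LogLink IsFull lat Frd IsoF Ob realify Strip
    IsoS Mv _ sig split ObΔ N _ qData tq t htq0 htq1 ht0 ht htq
  have hjF : T.E.j = ((jInv (((2 : ℕ) : ℚ) / (23 ^ 5 : ℕ)) : ℚ) : T.F) := by rw [T.j_eq]; exact eq_ratCast _ _
  have hl5 : 5 ≤ l := T.D.five_le_l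
  have hlP : l.Prime := T.D.l_prime
  have hlstar : (pilotDataOfK T.D T.K).lstar = (l - 1) / 2 := by
    show ((pilotDataOfK T.D T.K).l - 1) / 2 = (l - 1) / 2
    rw [pilotDataOfK_l]
  -- `d_mod = 1`: conjugate, isometric bad fibres
  have hFm : Module.finrank ℚ (fieldOfModuli T.E) = 1 := by
    rw [T.finrank_rat_fieldOfModuli_eq_dmod]
    exact dmod_eq_one_of_degree_le_one (by rw [degree_ratPoint])
  -- the per-prime data (e, D, h, ρin, ρout): `e` is the ACTUAL (unknown) index at some bad fibre point
  set eF : Nat.Primes → ℕ := fun pp =>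
    haveI : Fact (pp : ℕ).Prime := ⟨pp.2⟩
    if h : ∃ x : (thetaIndex (pilotDataOfK T.D T.K)).Fibre (.inr pp), placeOf (pilotDataOfK T.D T.K) pp.1 x ∈ (pilotDataOfK T.D T.K).S
    then absRamificationIdx (pp : ℕ) (kOf (pilotDataOfK T.D T.K) pp.1 h.choose) else 1 with heF
  set DF : Nat.Primes → ℕ := fun pp => if (pp : ℕ) = 3 then 2 * eF pp - 1 else eF pp - 1 with hDF
  set hF : Nat.Primes → ℕ := fun pp => if (pp : ℕ) = 3 then 20 else
      if (pp : ℕ) = 23 then 10 else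
      2 with hhF
  set rinF : Nat.Primes → ℤ := fun pp => if (pp : ℕ) = 23 then ((eF pp / 22 : ℕ) : ℤ) else 1 with hrinF
  set routF : Nat.Primes → ℤ := fun pp => if (pp : ℕ) = 3 then min ((3 : ℤ) ^ 3 - 3 * (eF pp : ℤ)) ((3 : ℤ) ^ 4 - 4 * (eF pp : ℤ)) else
      if (pp : ℕ) = 23 then min ((23 : ℤ) ^ 2 - 2 * (eF pp : ℤ)) ((23 : ℤ) ^ 1 - 1 * (eF pp : ℤ)) else
      min ((109 : ℤ) ^ 0 - 0 * (eF pp : ℤ)) ((109 : ℤ) ^ 1 - 1 * (eF pp : ℤ)) with hroutF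
  -- at a bad fibre point `x | p`: `e(K_x) = eF p`
  have heq : ∀ (pp : Nat.Primes) (x : (thetaIndex (pilotDataOfK T.D T.K)).Fibre (.inr pp)),
      haveI : Fact (pp : ℕ).Prime := ⟨pp.2⟩
      placeOf (pilotDataOfK T.D T.K) pp.1 x ∈ (pilotDataOfK T.D T.K).S →
        absRamificationIdx (pp : ℕ) (kOf (pilotDataOfK T.D T.K) pp.1 x) = eF pp := by
    intro pp x hx
    haveI : Fact (pp : ℕ).Prime := ⟨pp.2⟩
    have hex : ∃ x : (thetaIndex (pilotDataOfK T.D T.K)).Fibre (.inr pp),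
        placeOf (pilotDataOfK T.D T.K) pp.1 x ∈ (pilotDataOfK T.D T.K).S := ⟨x, hx⟩
    have h1 : eF pp = absRamificationIdx (pp : ℕ) (kOf (pilotDataOfK T.D T.K) pp.1 hex.choose) := by
      simp only [heF, dif_pos hex]
    rw [h1]
    exact WRow.absRamificationIdx_kOf_eq_of_finrank_eq_one T.D hFm pp x hex.choose
  -- the admissible shape of `eF` at each bad prime
  have hshape : ∀ (pp : Nat.Primes) (x : (thetaIndex (pilotDataOfK T.D T.K)).Fibre (.inr pp)),
      haveI : Fact (pp : ℕ).Prime := ⟨pp.2⟩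
      placeOf (pilotDataOfK T.D T.K) pp.1 x ∈ (pilotDataOfK T.D T.K).S →
        ∃ m : ℕ, 1 ≤ m ∧ eF pp = (if (pp : ℕ) = 3 then 6 else
      if (pp : ℕ) = 23 then 6 else
      15) * l * m := by
    intro pp x hx
    rw [← heq pp x hx]
    exact InhBand.shape_reyssat T pp x hx
  refine Cor312Prov.licence_settingPrVolSharp_pilotDataOfK_of_orders_rat T.D hlog M archPk archSub Ψ act Mmod region n lat sig split qData
    tq t htq0 htq1 ht0 ht htq (jInv (((2 : ℕ) : ℚ) / (23 ^ 5 : ℕ))) hjF eF DF hF rinF routF (fun pp x hx => ?_)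
    (fun pp x y _ _ => Cor312Prov.nonempty_algEquiv_kOf_of_finrank_eq_one T.D hFm pp x y) (fun pp hpp i => ?_)
  · -- the local packages at a bad place `x | p`
    haveI : Fact (pp : ℕ).Prime := ⟨pp.2⟩
    have hE := heq pp x hx
    obtain ⟨m, hm1, hm⟩ := hshape pp x hx
    obtain ⟨hpl, hcases⟩ := InhBand.bad_prime_reyssat T pp x hx
    rcases hcases with ⟨hp, hord⟩ | ⟨hp, hord⟩ | ⟨hp, hord⟩
    · -- `p = 3`: `e = 6·l·m`
      simp only [hp] at hm; norm_num at hm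
      have h3 : hF pp = 20 := by simp [hhF, hp]
      have hne : ∀ c : ℕ, (eF pp : ℤ) ≠ (((pp : ℕ) : ℕ) : ℤ) ^ c * ((((pp : ℕ) : ℕ) : ℤ) - 1) :=
        WRow.natCast_ne_pow_mul_sub_one hlP pp.2 (fun h => hpl h.symm)
          (fun h => by rw [hp] at h; have := Nat.le_of_dvd (by norm_num) h; omega) ⟨6 * m, by rw [hm]; ring⟩
      refine ⟨hE, ?_, ?_, ?_, by rw [h3]; simpa using hord, ⟨60 * m, by rw [h3, hm]; ring⟩⟩
      · have hd := GenuineK.sub_one_div_le_differentOrd_kOf_wild_ratPoint T pp (by rw [hp]; norm_num) (by rw [hp]; norm_num)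
          (t := 10) (by norm_num) (by rw [hp]; norm_num)
          (fun v hv => by rw [MShallowReyssat.ord_jInv_of_eq v hv (by rw [hp]; norm_num) (by rw [hp]; norm_num), hp, MShallowReyssat.factorization_three]) x
        rw [hE] at hd
        rw [show DF pp = 2 * eF pp - 1 by simp [hDF, hp]]
        exact hd
      · rw [show rinF pp = 1 by simp [hrinF, hp]]
        exact WRow.inner_witness_trivial (pp : ℕ) _ (eF pp)
      · exact WRow.outer_member_min (pp : ℕ) hE hne 3 4 (show (((pp : ℕ) : ℕ) : ℤ) = 3 by exact_mod_cast hp) (by simp [hroutF, hp])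
    · -- `p = 23`: `e = 6·l·m`
      simp only [hp] at hm; norm_num at hm
      have h3 : hF pp = 10 := by simp [hhF, hp]
      have hne : ∀ c : ℕ, (eF pp : ℤ) ≠ (((pp : ℕ) : ℕ) : ℤ) ^ c * ((((pp : ℕ) : ℕ) : ℤ) - 1) :=
        WRow.natCast_ne_pow_mul_sub_one Nat.prime_three pp.2 (by rw [hp]; norm_num) (by rw [hp]; norm_num) ⟨2 * l * m, by rw [hm]; ring⟩
      refine ⟨hE, ?_, ?_, ?_, by rw [h3]; simpa using hord, ⟨30 * m, by rw [h3, hm]; ring⟩⟩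
      · rw [show DF pp = eF pp - 1 by simp [hDF, hp]]
        exact Cor312Prov.pred_div_le_differentOrd_of_eq (pp : ℕ) hE
      · exact WRow.inner_witness_slot (pp : ℕ) (by rw [hp]; norm_num) hE (show rinF pp = _ by simp [hrinF, hp])
      · exact WRow.outer_member_min (pp : ℕ) hE hne 2 1 (show (((pp : ℕ) : ℕ) : ℤ) = 23 by exact_mod_cast hp) (by simp [hroutF, hp])
    · -- `p = 109`: `e = 15·l·m`
      simp only [hp] at hm; norm_num at hm
      have h3 : hF pp = 2 := by simp [hhF, hp]
      have hne : ∀ c : ℕ, (eF pp : ℤ) ≠ (((pp : ℕ) : ℕ) : ℤ) ^ c * ((((pp : ℕ) : ℕ) : ℤ) - 1) :=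
        WRow.natCast_ne_pow_mul_sub_one Nat.prime_five pp.2 (by rw [hp]; norm_num) (by rw [hp]; norm_num) ⟨3 * l * m, by rw [hm]; ring⟩
      refine ⟨hE, ?_, ?_, ?_, by rw [h3]; simpa using hord, ⟨15 * m, by rw [h3, hm]; ring⟩⟩
      · rw [show DF pp = eF pp - 1 by simp [hDF, hp]]
        exact Cor312Prov.pred_div_le_differentOrd_of_eq (pp : ℕ) hE
      · rw [show rinF pp = 1 by simp [hrinF, hp]]
        exact WRow.inner_witness_trivial (pp : ℕ) _ (eF pp)
      · exact WRow.outer_member_min (pp : ℕ) hE hne 0 1 (show (((pp : ℕ) : ℕ) : ℤ) = 109 by exact_mod_cast hp) (by simp [hroutF, hp])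
  · -- the integer cells at every label `j = i + 1 ≤ (l−1)/2`, every level `l`
    haveI : Fact (pp : ℕ).Prime := ⟨pp.2⟩
    obtain ⟨x, hx⟩ := hpp
    have hi : (i : ℕ) < (l - 1) / 2 := hlstar ▸ i.isLt
    generalize hk : (i : ℕ) = k at hi ⊢
    obtain ⟨m, hm1, hm⟩ := hshape pp x hx
    obtain ⟨-, hcases⟩ := InhBand.bad_prime_reyssat T pp x hx
    rcases hcases with ⟨hp, -⟩ | ⟨hp, -⟩ | ⟨hp, -⟩
    · simp only [hp] at hm; norm_num at hm
      have h2 : DF pp = 2 * (6 * l * m) - 1 := by simp [hDF, hp, hm]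
      have h3 : hF pp = 20 := by simp [hhF, hp]
      have h4 : rinF pp = (1 : ℤ) := by simp [hrinF, hp]
      have h5 : routF pp = min ((3 : ℤ) ^ 3 - 3 * (eF pp : ℤ)) ((3 : ℤ) ^ 4 - 4 * (eF pp : ℤ)) := by simp [hroutF, hp]
      rw [h2, h3, h4, h5, hm]
      exact InhBand.cell_frey343_p3 (show 5 ≤ l by omega) hm1 k hi
    · simp only [hp] at hm; norm_num at hm
      have h2 : DF pp = 6 * l * m - 1 := by simp [hDF, hp, hm]
      have h3 : hF pp = 10 := by simp [hhF, hp]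
      have h4 : rinF pp = (((6 * l * m / 22 : ℕ) : ℤ)) := by simp [hrinF, hp, hm]
      have h5 : routF pp = min ((23 : ℤ) ^ 2 - 2 * (eF pp : ℤ)) ((23 : ℤ) ^ 1 - 1 * (eF pp : ℤ)) := by simp [hroutF, hp]
      rw [h2, h3, h4, h5, hm]
      exact InhBand.cell_reyssat_p23_from151 (show 151 ≤ l by omega) (fun h => by rw [h] at hlP; norm_num at hlP) hm1 k hi
    · simp only [hp] at hm; norm_num at hm
      have h2 : DF pp = 15 * l * m - 1 := by simp [hDF, hp, hm]
      have h3 : hF pp = 2 := by simp [hhF, hp]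
      have h4 : rinF pp = (1 : ℤ) := by simp [hrinF, hp]
      have h5 : routF pp = min ((109 : ℤ) ^ 0 - 0 * (eF pp : ℤ)) ((109 : ℤ) ^ 1 - 1 * (eF pp : ℤ)) := by simp [hroutF, hp]
      rw [h2, h3, h4, h5, hm]
      exact InhBand.cell_reyssat_p109 (show 5 ≤ l by omega) hm1 k hi

/-- **BRANCH C's PER-DATUM ANTECEDENT «∃ ρ qK, QPinned ∧ PilotKummerCompatHull» INHABITED at every genuine datum over `(ratPoint (2/23⁵), l)`, EVERY
prime `l ≥ 151`** (any columns `col`; every pair of realising Θ- and q-ideles, the CHOSEN ones of the window certificates' `hSHw`/`hSHwBad` binders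
included — abc-iut-w5-d009's `exists_qPinned_and_hull_settingPrVolSharp_iff_licence`, realising q-ideles having norm `≤ 1`): the per-datum S_H object of
the certificates of record (p453137 / p450130 / p447945) HOLDS at this datum class at every such level — the R-W table's datum `frey-2-6436341-6436343 (Reyssat)`
decided on the inhabited side by ONE theorem. [cite: Mochizuki2012, IUTchIII Cor. 3.12 Step (xi-d) p. 183, (xi-f) p. 184]
[cite: DupuyHilado2025, §3.3, §3.4, §4.9] [claim: Mochizuki2012, status: disputed] -/
theorem WRow.exists_qPinned_and_hull_reyssat_from151_uniform {l : ℕ} (hl : 151 ≤ l) (T : Cor22.ThetaVolumeDatumAt (ratPoint (((2 : ℕ) : ℚ) / (23 ^ 5 : ℕ))) l) :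
    letI := T.instFieldF; letI := T.instNumberFieldF; letI := T.instAlgebraF; letI := T.instFieldK
    letI := T.instNumberFieldK; letI := T.instAlgebraK; letI := T.instFieldFbar; letI := T.instAlgebraFbar
    letI := T.instAlgebraKFbar; letI := T.instIsElliptic
    ∀ {logv : PadicLogs T.K} (hlog : LogvAnalytic logv) (M : Type) [Field M] [NumberField M]
      (archPk : ∀ (j : (thetaIndex (pilotDataOfK T.D T.K)).Label) (vQ : (thetaIndex (pilotDataOfK T.D T.K)).VQ),
        Set ((logShellsDH (pilotDataOfK T.D T.K) logv).Packet j vQ))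
      (archSub : ∀ (j : (thetaIndex (pilotDataOfK T.D T.K)).Label) (v : (thetaIndex (pilotDataOfK T.D T.K)).V),
        Set ((logShellsDH (pilotDataOfK T.D T.K) logv).Packet j ((thetaIndex (pilotDataOfK T.D T.K)).over v)))
      (Ψ : ℤ → ∀ v : (thetaIndex (pilotDataOfK T.D T.K)).V, v ∈ (thetaIndex (pilotDataOfK T.D T.K)).Vbad →
        Set ((logShellsDH (pilotDataOfK T.D T.K) logv).StarPacket v))
      (act : ℤ → ∀ v : (thetaIndex (pilotDataOfK T.D T.K)).V, v ∈ (thetaIndex (pilotDataOfK T.D T.K)).Vbad →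
        (logShellsDH (pilotDataOfK T.D T.K) logv).StarPacket v → Module.End ℚ ((logShellsDH (pilotDataOfK T.D T.K) logv).StarPacket v))
      (Mmod : ℤ → ∀ j : (thetaIndex (pilotDataOfK T.D T.K)).LabelStar, Set ((logShellsDH (pilotDataOfK T.D T.K) logv).GlobalPacket j.1))
      (region : ℤ → ∀ j : (thetaIndex (pilotDataOfK T.D T.K)).LabelStar, FinDivisor M → ∀ vQ : (thetaIndex (pilotDataOfK T.D T.K)).VQ,
        Set ((logShellsDH (pilotDataOfK T.D T.K) logv).Packet j.1 vQ))
      (n : ℤ) {HT : Type} {LogLink : HT → HT → Type} {IsFull : ∀ {s t : HT}, LogLink s t → Prop}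
      (lat : LGPGaussianLogThetaLattice LogLink IsFull)
      {Frd : Type} {IsoF : Frd → Frd → Type} {Ob : Frd → Type} {realify : Frd → Frd} {Strip : Type}
      {IsoS : Strip → Strip → Type} {Mv : ∀ v : (thetaIndex (pilotDataOfK T.D T.K)).V, v ∈ (thetaIndex (pilotDataOfK T.D T.K)).Vbad → Type}
      [∀ v h, Monoid (Mv v h)]
      (sig : GlobalLGPFrobenioidSignature (thetaIndex (pilotDataOfK T.D T.K)).lstar (thetaIndex (pilotDataOfK T.D T.K)).V
        (· ∈ (thetaIndex (pilotDataOfK T.D T.K)).Vbad) Frd IsoF Ob realify Strip IsoS Mv)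
      (split : SplittingMonoids Mv) {ObΔ : Type} {N : ∀ v : (thetaIndex (pilotDataOfK T.D T.K)).V, v ∈ (thetaIndex (pilotDataOfK T.D T.K)).Vbad → Type}
      [∀ v h, Monoid (N v h)] (qData : QPilotData ObΔ N)
      (tq : ∀ (pp : Nat.Primes) (x : (thetaIndex (pilotDataOfK T.D T.K)).Fibre (.inr pp)),
        haveI : Fact (pp : ℕ).Prime := ⟨pp.2⟩; kOf (pilotDataOfK T.D T.K) pp.1 x)
      (t : ∀ (pp : Nat.Primes) (_ : Fin (pilotDataOfK T.D T.K).lstar) (x : (thetaIndex (pilotDataOfK T.D T.K)).Fibre (.inr pp)),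
        haveI : Fact (pp : ℕ).Prime := ⟨pp.2⟩; kOf (pilotDataOfK T.D T.K) pp.1 x)
      (htq0 : ∀ pp x, tq pp x ≠ 0)
      (htq1 : ∀ (pp : Nat.Primes) (x : (thetaIndex (pilotDataOfK T.D T.K)).Fibre (.inr pp)),
        haveI : Fact (pp : ℕ).Prime := ⟨pp.2⟩; placeOf (pilotDataOfK T.D T.K) pp.1 x ∉ (pilotDataOfK T.D T.K).S → ‖tq pp x‖ = 1)
      (col : ℤ → Column (logShellsDH (pilotDataOfK T.D T.K) logv))
      (_ht0 : ∀ pp i x, t pp i x ≠ 0)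
      (_ht : ∀ (pp : Nat.Primes) (i : Fin (pilotDataOfK T.D T.K).lstar) (x : (thetaIndex (pilotDataOfK T.D T.K)).Fibre (.inr pp)),
        haveI : Fact (pp : ℕ).Prime := ⟨pp.2⟩
        Real.log ‖t pp i x‖ = -((pilotDataOfK T.D T.K).thetaPilot i (placeOf (pilotDataOfK T.D T.K) pp.1 x)) *
          logNorm T.K (placeOf (pilotDataOfK T.D T.K) pp.1 x) / localDegree T.K (placeOf (pilotDataOfK T.D T.K) pp.1 x))
      (_htq : ∀ (pp : Nat.Primes) (x : (thetaIndex (pilotDataOfK T.D T.K)).Fibre (.inr pp)),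
        haveI : Fact (pp : ℕ).Prime := ⟨pp.2⟩
        Real.log ‖tq pp x‖ = -((pilotDataOfK T.D T.K).qPilot (placeOf (pilotDataOfK T.D T.K) pp.1 x)) *
          logNorm T.K (placeOf (pilotDataOfK T.D T.K) pp.1 x) / localDegree T.K (placeOf (pilotDataOfK T.D T.K) pp.1 x)),
      ∃ (ρ : (∀ v : (thetaIndex (pilotDataOfK T.D T.K)).V, v ∈ (thetaIndex (pilotDataOfK T.D T.K)).Vbad →
              Set ((logShellsDH (pilotDataOfK T.D T.K) logv).StarPacket v)) →
            ∀ (j : (thetaIndex (pilotDataOfK T.D T.K)).Label) (vQ : (thetaIndex (pilotDataOfK T.D T.K)).VQ),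
              Set ((logShellsDH (pilotDataOfK T.D T.K) logv).Packet j vQ))
          (qK : ∀ v : (thetaIndex (pilotDataOfK T.D T.K)).V, v ∈ (thetaIndex (pilotDataOfK T.D T.K)).Vbad →
            Set ((logShellsDH (pilotDataOfK T.D T.K) logv).StarPacket v)),
          QPinned ({ toSituation := situationPrVol (pilotDataOfK T.D T.K) hlog M archPk archSub Ψ act Mmod region, col := col } :
              LatticeSituation (thetaIndex (pilotDataOfK T.D T.K)))
            (settingPrVolSharp (pilotDataOfK T.D T.K) hlog M archPk archSub Ψ act Mmod region n lat sig split qData tq t htq0 htq1) ρ qK ∧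
          PilotKummerCompatHull ({ toSituation := situationPrVol (pilotDataOfK T.D T.K) hlog M archPk archSub Ψ act Mmod region, col := col } :
              LatticeSituation (thetaIndex (pilotDataOfK T.D T.K)))
            (settingPrVolSharp (pilotDataOfK T.D T.K) hlog M archPk archSub Ψ act Mmod region n lat sig split qData tq t htq0 htq1) ρ qK := by
  letI := T.instFieldF; letI := T.instNumberFieldF; letI := T.instAlgebraF; letI := T.instFieldK
  letI := T.instNumberFieldK; letI := T.instAlgebraK; letI := T.instFieldFbar; letI := T.instAlgebraFbar
  letI := T.instAlgebraKFbar; letI := T.instIsElliptic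
  intro logv hlog M _ _ archPk archSub Ψ act Mmod region n HT LogLink IsFull lat Frd IsoF Ob realify Strip
    IsoS Mv _ sig split ObΔ N _ qData tq t htq0 htq1 col ht0 ht htq
  exact (exists_qPinned_and_hull_settingPrVolSharp_iff_licence (pilotDataOfK T.D T.K) hlog M archPk archSub Ψ act Mmod region n lat sig
    split qData tq t htq0 htq1 col (fun pp x => norm_qIdele_le_one_of_realises (pilotDataOfK T.D T.K) tq htq0 htq pp x)).2
    (WRow.licence_reyssat_from151_uniform hl T hlog M archPk archSub Ψ act Mmod region n lat sig split qData tq t htq0 htq1 ht0 ht htq)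

end Summit.ABC.IUTFork.Conditional

end
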